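import Summits.BirchSwinnertonDyer.BirchSwinnertonDyer.Theorems.ErratumRoadFiveJetchevAtPSwapEnd
import Summits.BirchSwinnertonDyer.BirchSwinnertonDyer.Theorems.ErratumRoadFiveJetchevAtPSupplyOfHGZ
import HarnessLib

/-!
# Crux `EulerHalfNotRamNoInertSetAtFive` (item stmt-BirchSwinnertonDyer-19715), S1b branch OVER AN hGZ RECEPTACLE — sites (i)–(ii):
# Jetchev's Thm. 1.4 (max form, HL currency) at the multiplicative `p` with [GZ86 III (3.1)] replaced by a FRAME RECEPTACLE

Cell `bsd-stepL`, seat `bsd-line-er5-p1-w2` g6 (D-0154 width seat -w2; LEAD `bsd-line-er5-p1` g3), `--supports stmt-BirchSwinnertonDyer-19715`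
(helper). THEOREMS ONLY (no definition, no named fact, no `sorry`). Sequel of `…Theorems.ErratumRoadFiveJetchevAtPSupplyOfHGZ` (site (i)).

WHY. The named fact `Gross1991_heegnerPoint_sub_ratTorsion_mem_E0` (conjunct 2 of item 27981, [GZ86 III (3.1)]) reaches crux 19715's S1b branch
through three hGZ adapters; width seat -w5 g0's «modular aux-norm» (p651087–p651089, p651502, …) supplies that receptacle on S1b rows from tree
theorems. This file re-threads the two Jetchev-side consumers over the receptacle AT THE FRAME (hypothesis placed right after `(Dt) (β) (ι)`, body =
conclusion of `JET.hGZ_of_Gross1991` VERBATIM), proofs = the originals' texts with `forall_hGZ_of_Gross1991 hF1 …` replaced by the hypothesis: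

* `JET.Swap.levelRaising_of_hGZ` — site (ii): cell bsd-jet's kernel prime swap `levelRaising_of_literature` (McCallum Prop. 5.2 struck) over the receptacle.
  -- adapted from Summits/BirchSwinnertonDyer/BirchSwinnertonDyer/Theorems/Rank1ResidualJetSwapLevelRaisingLiterature.lean
* `AtP.Koly.hlevAtP_of_prop44_of_poitouTate_of_hGZ` — the per-level inequality `hlev` over the receptacle (supply := site (i)'s
  `selmerSupplyAtP_of_poitouTate_hGZ`).
  -- adapted from Summits/BirchSwinnertonDyer/BirchSwinnertonDyer/Theorems/ErratumRoadFiveJetchevAtPSwapEnd.lean (§1)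
* **`AtP.Koly.jetchevMaxHLAtP_of_swapLiterature_of_hGZ (p) (hp2) (h372 hGZ hmod hPT)`** — HL at a general odd `p` over the receptacle, modulo FOUR
  printed facts (the original's five minus [GZ86 III (3.1)]).
  -- adapted from Summits/BirchSwinnertonDyer/BirchSwinnertonDyer/Theorems/ErratumRoadFiveJetchevAtPSwapEnd.lean (§2–§3)

HONEST FRAMING: CONDITIONAL on the displayed named facts (cite-only hypotheses; `hPT` typed-not-proved) and on the receptacle hypothesis; nothing
booked; no census label moves (T7); crux 19715 is NOT closed by this helper; no summit statement is touched; BSD is proved for no curve.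
[cite: Jetchev2008, Thm. 1.4 (p. 812), Lemma 5.1, Lemma 5.2, Prop. 5.3, Proof of Thm. 1.1 (pp. 820–824)] [cite: McCallumLMS1991, §4 Prop. 4.4, §5 Prop. 5.2 and proof (pp. 304–306)]
[cite: GrossLMS1991, Prop. 3.7 (2), §5 Prop. 5.3, §6 Prop. 6.2 (1)] [cite: GrossZagier1986, I (6.3), III (3.1)] [cite: MilneADT2006, Ch. I, Thm. 4.10(b)]
[cite: Nekovar2007, Prop. 4.13 (ii)]
-/

set_option autoImplicit false

noncomputable section

/-! ### §1 Site (ii): level raising at minimal depth over the receptacle (cell bsd-jet's kernel prime swap) -/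

section LevelRaising

open scoped Classical Pointwise

open Function NumberField IsDedekindDomain WeierstrassCurve Field
open Literature.NumberTheory.EllipticCurves Literature.NumberTheory.GaloisRepresentations
open Literature.NumberTheory.EllipticCurves.Jetchev2008 Literature.NumberTheory.EllipticCurves.KolyvaginCocycle
open Literature.NumberTheory.EllipticCurves.ModularForms
open Literature.NumberTheory.GaloisCohomology Literature.NumberTheory.Automorphic
open Literature.NumberTheory.GaloisRepresentations.DiscreteGaloisModule (transverseSubgroup SelmerStructure)
open Summit.BirchSwinnertonDyer.Rank1Residual.JET.SelmerVocabulary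
open Summit.BirchSwinnertonDyer.Rank1Residual.JET.GlobalDuality
open Summit.BirchSwinnertonDyer.Rank1Residual.X11b
open Summit.BirchSwinnertonDyer.Rank1Residual.X11b.Three
open Summit.BirchSwinnertonDyer.BirchSwinnertonDyer.Theorems

namespace Summit.BirchSwinnertonDyer.Rank1Residual.JET.Swap

set_option maxHeartbeats 800000 in
/-- **LEVEL RAISING AT MINIMAL DEPTH (`hR` of cell bsd-jet's bricks 5–6) from TWO named Literature statements + the hGZ RECEPTACLE AT THE FRAME**
— `JET.Swap.levelRaising_of_literature` (p-generic, `Theorems/Rank1ResidualJetSwapLevelRaisingLiterature.lean`) with its named fact `hF1`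
([GZ86 III (3.1)]) replaced by the receptacle hypothesis placed right after `(Dt) (β) (ι)` (body = conclusion of `JET.hGZ_of_Gross1991` VERBATIM):
Kolyvagin's prime-swap walk (brick 4) with the Poitou–Tate package, a Weil datum, the global intrinsic transverse family and its four local facts,
and McCallum 4.4 (from Gross 3.7 (2)) supplied by name; proof = the original's text with `forall_hGZ_of_Gross1991 hF1 …` replaced by the hypothesis.
  -- adapted from Summits/BirchSwinnertonDyer/BirchSwinnertonDyer/Theorems/Rank1ResidualJetSwapLevelRaisingLiterature.lean [cite: McCallumLMS1991, §5 Prop. 5.2 (p. 304)]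
[cite: Jetchev2008, Lemma 5.1, Lemma 5.2 (iii)] [cite: GrossZagier1986, III (3.1)] -/
theorem levelRaising_of_hGZ
    (hPT : ∀ (K : Type) [Field K] [NumberField K], poitouTate_selmerStructure_duality_conj K)
    (h372 : GrossLMS1991.prop37_2_frobeniusCongruence) :
    ∀ (W : WeierstrassCurve ℚ) [W.IsElliptic] [W.IsGloballyMinimal] [NeZero (W.conductorNorm ℤ)],
      ¬ W.HasCM → ∀ (K : Type) [Field K] [NumberField K], IsImaginaryQuadratic K →
      NumberField.discr K ≠ -3 → NumberField.discr K ≠ -4 →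
      SatisfiesHeegnerHypothesis (W.conductorNorm ℤ) K →
      ∀ (p : ℕ) [Fact p.Prime], p ≠ 2 → (∀ n : ℕ, W.HasSurjectiveModNGaloisRep (p ^ n : ℕ)) →
      ∀ (Dt : ModularParametrizationData W (W.conductorNorm ℤ)) (β : ℤ) (ι : K →+* ℂ),
      (∃ n' : ℤ, IsCoprime (p : ℤ) n' ∧ ∀ (m : ℕ), Squarefree m →
        (∀ q ∈ m.primeFactors, Zhang2014.IsKolyvaginPrime (W.conductorNorm ℤ) W K p q) →
        ∀ (dm : KolyvaginHeegnerData Dt β ι m)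
          (γ : ringClassField K ι m ≃ₐ[ℚ] ringClassField K ι m), γ ∈ ringClassGal ι m →
          ∀ v : HeightOneSpectrum (𝓞 K), ¬ (W.baseChange K).HasGoodReductionAt v →
            n' • pointsMap (W.baseChange K) (v.adicCompletion K)
                (dm.toGeomPoints (pointGalHom W (ringClassField K ι m) γ dm.y)) ∈
              E0Receptacle (W.baseChange K) v ∧
            ∀ (ℓ : ℕ), ℓ ∈ m.primeFactors → ∀ (dm' : KolyvaginHeegnerData Dt β ι (m / ℓ))
              (hle : ringClassField K ι (m / ℓ) ≤ ringClassField K ι m),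
              n' • pointsMap (W.baseChange K) (v.adicCompletion K)
                  (dm.toGeomPoints (pointGalHom W (ringClassField K ι m) γ
                    (WeierstrassCurve.Affine.Point.map (W' := W)
                      ((RingClassField.inclusion ι hle).restrictScalars ℚ) dm'.y))) ∈
                E0Receptacle (W.baseChange K) v) →
      ∀ (u : ℕ),
      (∀ (c : ℕ), Squarefree c →
        (∀ q ∈ c.primeFactors, Zhang2014.IsKolyvaginPrime (W.conductorNorm ℤ) W K p q ∧
          1 + u ≤ Zhang2014.kolyvaginIndex W p q) →
        ∀ dc : KolyvaginHeegnerData Dt β ι c,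
        ∃ Q : (W.baseChange (ringClassField K ι c)).toAffine.Point,
          ((p ^ u : ℕ) : ℤ) • Q = dc.derivedPoint) →
      ∀ (n₀ : ℕ), Squarefree n₀ →
        (∀ q ∈ n₀.primeFactors, Zhang2014.IsKolyvaginPrime (W.conductorNorm ℤ) W K p q ∧
          1 + u ≤ Zhang2014.kolyvaginIndex W p q) →
        ∀ d₀ : KolyvaginHeegnerData Dt β ι n₀,
        (¬ ∃ Q : (W.baseChange (ringClassField K ι n₀)).toAffine.Point,
          ((p ^ (u + 1) : ℕ) : ℤ) • Q = d₀.derivedPoint) →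
        ∀ m' : ℕ, ∃ (n : ℕ) (d : KolyvaginHeegnerData Dt β ι n), Squarefree n ∧
          (∀ q ∈ n.primeFactors, Zhang2014.IsKolyvaginPrime (W.conductorNorm ℤ) W K p q ∧
            max m' (1 + u) ≤ Zhang2014.kolyvaginIndex W p q) ∧
          ¬ ∃ Q : (W.baseChange (ringClassField K ι n)).toAffine.Point,
            ((p ^ (u + 1) : ℕ) : ℤ) • Q = d.derivedPoint := by
  intro W _ _ _ hcm K _ _ hK hD3 hD4 hH p _ hp2 htower Dt β ι hRcp u hmin n₀ hn₀ hn₀K d₀ hd₀ m'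
  have hp : p.Prime := Fact.out
  have hD : NumberField.discr K < -4 := KolyvaginAssembly.discr_lt_neg_four hK ⟨hD3, hD4⟩
  haveI : ∀ j : ℕ, NumberField (ringClassField K ι j) := numberField_ringClassField K hK ι
  obtain ⟨τ, hτ⟩ := exists_algEquiv_ne_one_of_isImaginaryQuadratic K hK
  have hττ : τ * τ = 1 := mul_self_eq_one_of_isImaginaryQuadratic hK τ
  -- instances at level `p`
  haveI : NeZero (p ^ 1) := ⟨pow_ne_zero 1 hp.ne_zero⟩
  haveI : Finite (geomTorsion (W.baseChange K) ((p ^ 1 : ℕ) : ℤ)) :=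
    finite_geomTorsion_of_neZero (W.baseChange K) (p ^ 1)
  -- the Poitou–Tate package and a `τ`-equivariant Weil datum at level `p`
  obtain ⟨inv, hperf, hvan, -, hSC, hconj⟩ := hPT K (p ^ 1)
  have h2 : 2 ≤ p ^ 1 := by rw [pow_one]; exact hp.two_le
  obtain ⟨e, hμ, hadd₁, hadd₂, hgal, halt, hnondeg, hτe⟩ := exists_weilDatum_liftAut W τ (p ^ 1) h2
  -- the global intrinsic transverse family at level `p` and its local facts
  obtain ⟨𝒯, h𝒯, -⟩ := Walk.exists_globalTransverseFamily W ι ((p ^ 1 : ℕ) : ℤ)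
  have h𝒯σ' : ∀ (c : ℕ), Squarefree c →
      (∀ q ∈ c.primeFactors, Zhang2014.IsKolyvaginPrime (W.conductorNorm ℤ) W K p q) →
      ∀ (v w : HeightOneSpectrum (𝓞 K)) (h : τ • v = w), v ∈ placesDividing K c →
      ∀ x : galoisCohomology (((W.baseChange K).torsionGaloisModule ((p ^ 1 : ℕ) : ℤ)).toLocal
        (Sum.inr v : Place K)) 1,
      x ∈ 𝒯 (Sum.inr v) → conjActPlace W τ ((p ^ 1 : ℕ) : ℤ) h x ∈ 𝒯 (Sum.inr w) :=
    fun c hc _ v w h hv x hx ↦ Walk.globalTransverse_conjActPlace_mem h𝒯 τ hc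
      (forall_conjActPlace_mem_of_eq_iInf_transverseSubgroup W hK ι τ _ c) v w h hv x hx
  have h𝒯sd' : ∀ (c : ℕ), Squarefree c →
      (∀ q ∈ c.primeFactors, Zhang2014.IsKolyvaginPrime (W.conductorNorm ℤ) W K p q) →
      ∀ v ∈ placesDividing K c,
      inv.dualTransported 𝒯 (weilDualIntertwining (W.baseChange K) (p ^ 1) e hμ hadd₁ hadd₂ hgal)
        (Sum.inr v) = 𝒯 (Sum.inr v) :=
    fun c hc hcK ↦ Walk.globalTransverse_dualTransported_eq (ι := ι) h𝒯 hc
      (fun 𝒯c h𝒯c inv' hperf' w' hw' ↦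
        RingClassTransverse.dualTransported_eq_of_localTransverseFamily W K hK hD ι p hp2 1 le_rfl c hc
          hcK (fun ℓ hℓ ↦ (hcK ℓ hℓ).2.2.2.2.2) 𝒯c h𝒯c e hμ hadd₁ hadd₂ hgal halt hnondeg inv' hperf' w' hw')
      inv hperf
  have hloc' : ∀ ℓ : ℕ, Zhang2014.IsKolyvaginPrime (W.conductorNorm ℤ) W K p ℓ →
      1 ≤ Zhang2014.kolyvaginIndex W p ℓ →
      ∀ (v : HeightOneSpectrum (𝓞 K)), (ℓ : 𝓞 K) ∈ v.asIdeal → ∀ (hfix : τ • v = v) (s : ℤ),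
      (s = 1 ∨ s = -1) →
      ((W.baseChange K).kummerSelmerStructure ((p ^ 1 : ℕ) : ℤ) (Sum.inr v)).relIndex
        ((conjActPlace W τ ((p ^ 1 : ℕ) : ℤ) hfix - s • AddMonoidHom.id _).ker) = p ^ 1 :=
    fun ℓ hℓ hk v hv hfix s hs ↦
      kolyvaginLocalTerm_of_poitouTate hPT W K hK τ hτ p 1 hp2 le_rfl ℓ hℓ hk v hv hfix s hs
  have hdisj' : ∀ ℓ : ℕ, Zhang2014.IsKolyvaginPrime (W.conductorNorm ℤ) W K p ℓ →
      ∀ v : HeightOneSpectrum (𝓞 K), (ℓ : 𝓞 K) ∈ v.asIdeal →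
      Disjoint ((W.baseChange K).kummerSelmerStructure ((p ^ 1 : ℕ) : ℤ) (Sum.inr v)) (𝒯 (Sum.inr v)) :=
    fun ℓ hℓ v hv ↦ Walk.globalTransverse_disjoint_kummer h𝒯
      (P := fun ℓ ↦ Zhang2014.IsKolyvaginPrime (W.conductorNorm ℤ) W K p ℓ)
      (fun ℓ hℓ w hw ↦ Walk.disjoint_kummer_iInf_transverseSubgroup W K hK hD ι 1 hℓ w hw)
      (fun ℓ hℓ ↦ hℓ.1) ℓ hℓ v hv
  -- the hGZ receptacle at this frame (in the original: [GZ86 III (3.1)] via `forall_hGZ_of_Gross1991 hF1`); McCallum 4.4 from Gross 3.7 (2)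
  obtain ⟨n', hcop', hGZ'⟩ := hRcp
  exact exists_conductor_levelIndex_ge_of_minDepth W τ p e hμ hadd₁ hadd₂ hgal halt hnondeg hτe hK hD3
    hD4 hH hcm hp2 htower hτ hττ Dt β ι (prop44_of_frobeniusCongruence h372) inv hperf hvan hSC (hconj τ)
    𝒯 h𝒯 h𝒯σ' h𝒯sd' hloc' hdisj' hcop' hGZ' hmin hn₀ hn₀K d₀ hd₀ m'


end Summit.BirchSwinnertonDyer.Rank1Residual.JET.Swap

end LevelRaising

/-! ### §2 Site (i) composed: the per-level inequality and HL(`p`) over the receptacle -/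

section HL

open scoped Classical NumberField

namespace Summit.BirchSwinnertonDyer.Rank1Residual.X11b.AtP.Koly

open WeierstrassCurve IsDedekindDomain NumberField Field Literature.NumberTheory.EllipticCurves
  Literature.NumberTheory.EllipticCurves.ModularForms Literature.NumberTheory.EllipticCurves.Jetchev2008
  Literature.NumberTheory.EllipticCurves.KolyvaginCocycle
  Literature.NumberTheory.EllipticCurves.Rank1Residual Literature.NumberTheory.GaloisRepresentations
  Literature.NumberTheory.GaloisRepresentations.DiscreteGaloisModule
  Literature.NumberTheory.GaloisCohomology Literature.NumberTheory.Automorphic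
  Summit.BirchSwinnertonDyer.Rank1Residual.X11b Summit.BirchSwinnertonDyer.Rank1Residual.JET
  Summit.BirchSwinnertonDyer.Rank1Residual.X11b.Three.Koly

/-- **The per-level inequality `hlev` at the frames of HL(`p`), general odd `p`, OVER THE hGZ RECEPTACLE** — `AtP.Koly.hlevAtP_of_prop44_of_poitouTate_of_Gross1991`
(p616968, `…JetchevAtPSwapEnd` §1) with its named fact `hF1` ([GZ86 III (3.1)]) replaced by the receptacle hypothesis placed right after `(Dt) (β) (ι)`;
modulo the named Literature facts {McCallum Prop. 4.4 `h44`, Gross–Zagier, modularity, Poitou–Tate for Selmer structures}; proof = the original's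
text with the supply taken from `selmerSupplyAtP_of_poitouTate_hGZ`. CONDITIONAL; nothing asserted about any curve.
[cite: Jetchev2008, Lemma 5.1, Prop. 5.3, Thm. 5.2, Proof of Thm. 1.1 (pp. 820–824)] [cite: McCallumLMS1991, §4 Prop. 4.4]
[cite: GrossLMS1991, §5 Prop. 5.3, §6 Prop. 6.2 (1)] [cite: MilneADT2006, Ch. I, Thm. 4.10(b)] -/
theorem hlevAtP_of_prop44_of_poitouTate_of_hGZ (p : ℕ) [Fact p.Prime] (hp2 : p ≠ 2)
    (h44 : McCallum1991.prop44_localOrder_kolyvaginClass_mul_eq)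
    (hGZ : ∀ (N : ℕ) [NeZero N] (W : WeierstrassCurve ℚ) (K : Type) [Field K] [NumberField K],
      gross_zagier N W K)
    (hmod : hasEntireLFunction_rat)
    (hPT : ∀ (K : Type) [Field K] [NumberField K], poitouTate_selmerStructure_duality_conj K) :
    ∀ (W : WeierstrassCurve ℚ) [W.IsElliptic] [W.IsGloballyMinimal] [NeZero (W.conductorNorm ℤ)]
      (K : Type) [Field K] [NumberField K]
      (Dt : ModularParametrizationData W (W.conductorNorm ℤ)) (β : ℤ) (ι : K →+* ℂ),
      (∃ n' : ℤ, IsCoprime (p : ℤ) n' ∧ ∀ (m : ℕ), Squarefree m →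
        (∀ q ∈ m.primeFactors, Zhang2014.IsKolyvaginPrime (W.conductorNorm ℤ) W K p q) →
        ∀ (dm : KolyvaginHeegnerData Dt β ι m)
          (γ : ringClassField K ι m ≃ₐ[ℚ] ringClassField K ι m), γ ∈ ringClassGal ι m →
          ∀ v : HeightOneSpectrum (𝓞 K), ¬ (W.baseChange K).HasGoodReductionAt v →
            n' • pointsMap (W.baseChange K) (v.adicCompletion K)
                (dm.toGeomPoints (pointGalHom W (ringClassField K ι m) γ dm.y)) ∈
              E0Receptacle (W.baseChange K) v ∧
            ∀ (ℓ : ℕ), ℓ ∈ m.primeFactors → ∀ (dm' : KolyvaginHeegnerData Dt β ι (m / ℓ))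
              (hle : ringClassField K ι (m / ℓ) ≤ ringClassField K ι m),
              n' • pointsMap (W.baseChange K) (v.adicCompletion K)
                  (dm.toGeomPoints (pointGalHom W (ringClassField K ι m) γ
                    (WeierstrassCurve.Affine.Point.map (W' := W)
                      ((RingClassField.inclusion ι hle).restrictScalars ℚ) dm'.y))) ∈
                E0Receptacle (W.baseChange K) v) →
      W.analyticRank = 1 → W.HasMultiplicativeReductionAtPrime p → Surj W p →
      IsImaginaryQuadratic K → SatisfiesHeegnerHypothesis (W.conductorNorm ℤ) K →
      Odd (NumberField.discr K) → NumberField.discr K ≠ -3 →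
      (W.quadraticTwist (NumberField.discr K : ℚ)).entireLFunction 1 ≠ 0 →
      (4 * (W.conductorNorm ℤ : ℤ)) ∣ β ^ 2 - NumberField.discr K → ¬ (p : ℤ) ∣ Dt.c →
      ∀ (v : HeightOneSpectrum (𝓞 ℚ)) (k n : ℕ) (d : KolyvaginHeegnerData Dt β ι n), Squarefree n →
        (∀ ℓ ∈ n.primeFactors, Zhang2014.IsKolyvaginPrime (W.conductorNorm ℤ) W K p ℓ) →
        (if divOrd d p < Zhang2014.levelIndex W p n then divOrd d p else (⊤ : ℕ∞)) < (k : ℕ∞) →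
        padicValNat p (W.tamagawaNumberAt v) ≤ k →
        (k : ℕ∞) + (if divOrd d p < Zhang2014.levelIndex W p n then divOrd d p else ⊤) ≤
          Zhang2014.levelIndex W p n →
        (padicValNat p (W.tamagawaNumberAt v) : ℕ∞) ≤
          (if divOrd d p < Zhang2014.levelIndex W p n then divOrd d p else ⊤) := by
  -- adapted from Summits/BirchSwinnertonDyer/BirchSwinnertonDyer/Theorems/ErratumRoadFiveJetchevAtPSwapEnd.lean (§1)
  intro W _ _ _ K _ _ Dt β ι hRcp hr hmult hρ hK hHN hodd hD3 hLt hβ hc3 v k n d hsq hkol h1 h2 h3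
  -- `k ≥ 1` and the admissibility of `n` at level `k`
  have hk : 1 ≤ k := by
    rcases Nat.eq_zero_or_pos k with rfl | hk
    · exact absurd h1 (by simp)
    · exact hk
  have hkM : (k : ℕ∞) ≤ Zhang2014.levelIndex W p n := le_trans le_self_add h3
  have hn : Squarefree n ∧ ∀ q ∈ n.primeFactors,
      Zhang2014.IsKolyvaginPrime (W.conductorNorm ℤ) W K p q ∧ k ≤ Zhang2014.kolyvaginIndex W p q :=
    ⟨hsq, fun q hq ↦ ⟨hkol q hq, Zhang2014.natCast_le_levelIndex_iff.mp hkM q hq⟩⟩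
  -- frame facts: complex conjugation, `(N, d_K) = 1`, `d_K < -4`
  obtain ⟨τ, hτ⟩ := exists_algEquiv_ne_one_of_isImaginaryQuadratic K hK
  have hND : IsCoprime ((W.conductorNorm ℤ : ℕ) : ℤ) (NumberField.discr K) :=
    KolyvaginAssembly.isCoprime_discr_of_satisfiesHeegnerHypothesis hK hHN
  have hD : NumberField.discr K < -4 := by
    have hneg : NumberField.discr K < 0 := hK.discr_neg
    have h4 : NumberField.discr K % 4 = 0 ∨ NumberField.discr K % 4 = 1 :=
      Literature.NumberTheory.QuadraticFields.Quadratic.discr_emod_four (K := K) hK.1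
    obtain ⟨r, hr⟩ := hodd
    omega
  -- Gross's one system of choices extending `d`, and Prop. 4.7 for it (from `h44`)
  have hcm : ¬ W.HasCM := not_hasCM_of_hasMultiplicativeReductionAtPrime' W hmult
  have htower : ∀ j : ℕ, W.HasSurjectiveModNGaloisRep (p ^ j : ℕ) :=
    forall_hasSurjectiveModNGaloisRep_pow_of_multiplicative_of_surj W p hp2 hmult hρ
  obtain ⟨D, hDd, h47⟩ := exists_data_h47Base_of_prop44 h44 W hcm hK hD hHN (p := p) hp2 htower
    Dt β ι hk hn d
  -- the sign `ε := −w(E)`, a sign function for it, and Gross Prop. 5.3 for the data — UNCONDITIONAL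
  -- (bsd-jet reader 1's `JET.exists_mem_ringClassGal_isOfFinAddOrder_conj_sub_smul`: Shimura reciprocity
  -- at conductor `m` + x11b3's `KolyvaginA53.h53_of_recM`; admissible conductors are `≠ 0`, prime to `N`)
  have hε : (-W.rootNumber : ℤ) = 1 ∨ (-W.rootNumber : ℤ) = -1 := by
    rcases W.rootNumber_eq_one_or with h | h <;> simp [h]
  obtain ⟨eb, heb, hebε⟩ := Walk.exists_signFunction (-W.rootNumber) hε
  have h53D : ∀ (s s' : {m : ℕ // Squarefree m ∧ ∀ q ∈ m.primeFactors,
        Zhang2014.IsKolyvaginPrime (W.conductorNorm ℤ) W K p q ∧ k ≤ Zhang2014.kolyvaginIndex W p q})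
      (_ : s'.1 ∣ s.1) (τm : ringClassField K ι s'.1 ≃ₐ[ℚ] ringClassField K ι s'.1),
      (∀ x : ringClassField K ι s'.1, ((τm x : ringClassField K ι s'.1) : ℂ) = starRingEnd ℂ x) →
      ∃ σ' ∈ ringClassGal ι s'.1, IsOfFinAddOrder
        (pointGalHom W (ringClassField K ι s'.1) τm (D s').y -
          (-W.rootNumber) • pointGalHom W (ringClassField K ι s'.1) σ' (D s').y) := by
    intro s s' _ τm hτm
    obtain ⟨hm0, hmN⟩ := ne_zero_and_coprime_of_isKolyvaginPrime (K := K) s'.2.1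
      (fun q hq ↦ (s'.2.2 q hq).1)
    exact exists_mem_ringClassGal_isOfFinAddOrder_conj_sub_smul W hK hHN Dt ι hm0 hmN (D s') τm hτm
  -- the supply at this frame, for these data and signs
  obtain ⟨𝒯, 𝒮, Qcar, C', hS, hQcar, hdisj, hPT, hselmer, hC, hdual_q, hsel0, hdual_ℓ⟩ :=
    selmerSupplyAtP_of_poitouTate_hGZ p hp2 hPT W K Dt β ι hRcp hr hmult hρ hK hHN hodd hD3 hLt hβ hc3 τ hτ
      v k hk h2 n d hn D hDd (-W.rootNumber) hε eb heb hebε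
  have h49 := h49_of_selmerMembership W hK hND hD (p := p) hp2 hρ Dt β ι hτ hk 𝒯 𝒮 Qcar D eb
    (-W.rootNumber) hebε h53D n hsel0
  have hordκ := hordκ_of_admissibleData W hK hND hD (p := p) hp2 hρ Dt β ι k D
  have hdivfin := fun s ↦ divOrd_ne_top_of_levelIndex_eq_top p W K
    (heegnerPointOfConductor_one_galoisConj_holds _ W K) (hGZ _ W K) hmod Dt β ι hr hK hHN hLt s (D s)
  have hfin := JET.Walk.hfin_of_kummer (K := K) W (Fact.out : p.Prime) k 𝒯
  have hκt := hκt_of_selmerMembership W hK hND hD (p := p) hp2 hρ Dt β ι hτ hk 𝒯 D eb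
    (-W.rootNumber) hebε h53D hdivfin hselmer
  have key := tamagawaExponent_le_m_of_orderedFamiliesBase W K hK p hp2 hρ Dt β ι τ hτ k
    (padicValNat p (W.tamagawaNumberAt v)) hk h2 𝒯 𝒮 hS Qcar hQcar D eb heb n hn ?_ ?_ hdisj hfin hPT
    (fun s _ ↦ hκt s) hordκ h47 C' hC hdual_q h49 hdual_ℓ
  · rw [hDd] at key
    exact key
  · rw [hDd]; exact h1
  · rw [hDd]; exact h3

/-- **HL at a general odd `p` (Jetchev's Thm. 1.4, max form, READ at `p ∥ N`, carrier `v = (p)` allowed) OVER THE hGZ RECEPTACLE, modulo FOUR named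
Literature facts** {Gross 1991 Prop. 3.7 (2) image-free `h372`, Gross–Zagier `hGZ`, modularity `hmod`, Poitou–Tate for Selmer structures `hPT`} —
`AtP.Koly.jetchevMaxHLAtP_of_swapLiterature` (p616968) with its fifth fact `hF1` ([GZ86 III (3.1)]) replaced by the receptacle hypothesis placed right after
`(Dt) (β) (ι)`: corner-p1's frame-free `Three.Koly.pDiv_of_swap_of_perLevel p` at the frame, fed with `hlev := hlevAtP_of_prop44_of_poitouTate_of_hGZ`
(McCallum 4.4 := `JET.prop44_of_frobeniusCongruence h372`) and `hswap :=` the kernel prime swap `JET.Swap.levelRaising_of_hGZ` transported to the frame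
exactly as in the original (`¬CM` ⟸ multiplicative at `p`; the `p`-adic tower ⟸ `Surj W p` ∧ multiplicative at the odd `p`; `d_K ≠ −4` ⟸ `d_K` odd).
CONDITIONAL, nothing asserted about any curve.
[cite: Jetchev2008, Thm. 1.4 (p. 812), Proof of Thm. 1.1 (pp. 820–824)] [cite: McCallumLMS1991, §4 Prop. 4.4, §5 Prop. 5.2 and proof (pp. 304–306)]
[cite: GrossLMS1991, Prop. 3.7 (2), §5 Prop. 5.3, §6 Prop. 6.2 (1)] [cite: MilneADT2006, Ch. I, Thm. 4.10(b)] -/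
theorem jetchevMaxHLAtP_of_swapLiterature_of_hGZ (p : ℕ) [Fact p.Prime] (hp2 : p ≠ 2)
    -- NAMED LITERATURE FACTS (cite-only)
    (h372 : GrossLMS1991.prop37_2_frobeniusCongruence)
    (hGZ : ∀ (N : ℕ) [NeZero N] (W : WeierstrassCurve ℚ) (K : Type) [Field K] [NumberField K],
      gross_zagier N W K)
    (hmod : hasEntireLFunction_rat)
    (hPT : ∀ (K : Type) [Field K] [NumberField K], poitouTate_selmerStructure_duality_conj K) :
    ∀ (W : WeierstrassCurve ℚ) [W.IsElliptic] [W.IsGloballyMinimal] [NeZero (W.conductorNorm ℤ)]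
      (K : Type) [Field K] [NumberField K]
      (Dt : ModularParametrizationData W (W.conductorNorm ℤ)) (β : ℤ) (ι : K →+* ℂ),
      (∃ n' : ℤ, IsCoprime (p : ℤ) n' ∧ ∀ (m : ℕ), Squarefree m →
        (∀ q ∈ m.primeFactors, Zhang2014.IsKolyvaginPrime (W.conductorNorm ℤ) W K p q) →
        ∀ (dm : KolyvaginHeegnerData Dt β ι m)
          (γ : ringClassField K ι m ≃ₐ[ℚ] ringClassField K ι m), γ ∈ ringClassGal ι m →
          ∀ v : HeightOneSpectrum (𝓞 K), ¬ (W.baseChange K).HasGoodReductionAt v →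
            n' • pointsMap (W.baseChange K) (v.adicCompletion K)
                (dm.toGeomPoints (pointGalHom W (ringClassField K ι m) γ dm.y)) ∈
              E0Receptacle (W.baseChange K) v ∧
            ∀ (ℓ : ℕ), ℓ ∈ m.primeFactors → ∀ (dm' : KolyvaginHeegnerData Dt β ι (m / ℓ))
              (hle : ringClassField K ι (m / ℓ) ≤ ringClassField K ι m),
              n' • pointsMap (W.baseChange K) (v.adicCompletion K)
                  (dm.toGeomPoints (pointGalHom W (ringClassField K ι m) γ
                    (WeierstrassCurve.Affine.Point.map (W' := W)
                      ((RingClassField.inclusion ι hle).restrictScalars ℚ) dm'.y))) ∈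
                E0Receptacle (W.baseChange K) v) →
      W.analyticRank = 1 → W.HasMultiplicativeReductionAtPrime p → Surj W p →
      IsImaginaryQuadratic K → SatisfiesHeegnerHypothesis (W.conductorNorm ℤ) K →
      Odd (NumberField.discr K) → NumberField.discr K ≠ -3 →
      (W.quadraticTwist (NumberField.discr K : ℚ)).entireLFunction 1 ≠ 0 →
      (4 * (W.conductorNorm ℤ : ℤ)) ∣ β ^ 2 - NumberField.discr K → ¬ (p : ℤ) ∣ Dt.c →
      ∀ (v : HeightOneSpectrum (𝓞 ℚ)) (s : ℕ), s ≤ padicValNat p (W.tamagawaNumberAt v) →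
        ∀ (n : ℕ) (d : KolyvaginHeegnerData Dt β ι n), Squarefree n →
          (∀ ℓ ∈ n.primeFactors, Zhang2014.IsKolyvaginPrime (W.conductorNorm ℤ) W K p ℓ ∧
            s ≤ Zhang2014.kolyvaginIndex W p ℓ) → PDiv d p s := by
  -- adapted from Summits/BirchSwinnertonDyer/BirchSwinnertonDyer/Theorems/ErratumRoadFiveJetchevAtPSwapEnd.lean (§2–§3)
  have hp : p.Prime := Fact.out
  intro W _ _ _ K _ _ Dt β ι hRcp hr hmult hρ hK hHN hodd hD3 hLt hβ hc3 v s hs n d hn hℓ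
  -- frame facts: `¬CM`, the `p`-adic tower, `d_K ≠ −4`
  have hcm : ¬ W.HasCM := not_hasCM_of_hasMultiplicativeReductionAtPrime' W hmult
  have htower : ∀ j : ℕ, W.HasSurjectiveModNGaloisRep (p ^ j : ℕ) :=
    forall_hasSurjectiveModNGaloisRep_pow_of_multiplicative_of_surj W p hp2 hmult hρ
  have hneg : NumberField.discr K < 0 := hK.discr_neg
  have hD4 : NumberField.discr K ≠ -4 := by
    have h4 : NumberField.discr K % 4 = 0 ∨ NumberField.discr K % 4 = 1 :=
      Literature.NumberTheory.QuadraticFields.Quadratic.discr_emod_four (K := K) hK.1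
    obtain ⟨r, hr⟩ := hodd
    omega
  -- `M + 1` versus `1 + M` in the admissibility clauses
  have hidx : ∀ {M c : ℕ}, (∀ q ∈ c.primeFactors, Zhang2014.IsKolyvaginPrime (W.conductorNorm ℤ) W K p q ∧
      1 + M ≤ Zhang2014.kolyvaginIndex W p q) → ∀ q ∈ c.primeFactors,
      Zhang2014.IsKolyvaginPrime (W.conductorNorm ℤ) W K p q ∧ M + 1 ≤ Zhang2014.kolyvaginIndex W p q :=
    fun h q hq ↦ ⟨(h q hq).1, by rw [Nat.add_comm]; exact (h q hq).2⟩
  refine pDiv_of_swap_of_perLevel p (padicValNat p (W.tamagawaNumberAt v)) ?_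
    (fun k n d hn' hℓ' h1 h2 h3 => hlevAtP_of_prop44_of_poitouTate_of_hGZ p hp2 (prop44_of_frobeniusCongruence h372)
      hGZ hmod hPT W K Dt β ι hRcp hr hmult hρ hK hHN hodd hD3 hLt hβ hc3 v k n d hn' hℓ' h1 h2 h3)
    s hs n d hn hℓ
  intro M e n d hsq hnK hall hnd
  -- Kolyvagin's prime swap in the kernel (cell bsd-jet), fed by the two named statements and the receptacle
  obtain ⟨n', d', hn', hn'K, hnd'⟩ := Swap.levelRaising_of_hGZ hPT h372 W hcm K hK hD3 hD4 hHN
    p hp2 htower Dt β ι hRcp M (fun c hc hcK dc ↦ hall c dc hc (hidx hcK)) n hsq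
    (fun q hq ↦ ⟨(hnK q hq).1, by rw [Nat.add_comm]; exact (hnK q hq).2⟩) d hnd e
  exact ⟨n', d', hn', fun q hq ↦ ⟨(hn'K q hq).1, le_trans (le_max_left _ _) (hn'K q hq).2⟩, hnd'⟩

end Summit.BirchSwinnertonDyer.Rank1Residual.X11b.AtP.Koly

end HL

end
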